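import Literature.AnabelianGeometry.SemiGraphs.TemperedSpecialFibreReductionsSchemaS3
import Literature.AnabelianGeometry.SemiGraphs.BTempResEquiv
import Literature.AnabelianGeometry.SemiGraphs.TemperoidsResProofs
import HarnessLib

/-!
# An EXPLICIT tempered fundamental group chart for the semi-graph of anabelioids WITH A CUSP
# `cuspGraph p`: `π₁^temp(cuspGraph p) = P = ℤ_p ⋊ (1 + pℤ_p)` ([SemiAnbd] Def. 3.5, Prop. 3.6 (ii);
# [IUTchI] §2 p. 44 "omission of cuspidal edges does not affect the tempered fundamental group")

Mochizuki, *Semi-graphs of anabelioids*, Publ. RIMS **42** (2006) [MochizukiSemiAnbd2006], §3 Def. 3.5 (i)(ii)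
(coverings / tempered coverings, p. 37), Prop. 3.6 (ii) (`B^temp(π₁^temp(𝒢)) ⥲ B^temp(𝒢)`, p. 38), Thm. 3.7 (i)
(verticial subgroups, p. 40), Prop. 3.2 (p. 35); Mochizuki, *Inter-universal Teichmüller theory I*, §2 p. 44
[cite: Mochizuki2012, §2 p.44].

Witness file of the abc-iut cell (block F, seat abc-iut-f-177; sequel of `WitnessIwahoriCusp.lean` and of
`TemperedSpecialFibreReductionsSchemaS3.lean` §1, in the pattern of abc-iut-L3-t2's `OneVertexWitnessChart.lean`
and abc-iut-w5-d236's `Prop36HypothesesWitnessAffChart.lean`, both untouched).  The charts of `cuspGraph p` used so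
far came from the general existence theorem `ProfiniteSemiGraph.temperedPiChart` (group = an inverse limit).
Here:

* for the cusp-omitted restriction `R := (cuspGraph p)|_{cuspOmission p}` (one vertex `P`, no edge; subtype
  vertex / edge types) EVERY covering is its `P`-set at the vertex and is TEMPERED (the stabiliser of a point is
  open, so contains a level box `Ker(P ↠ P_n)`, which is normal and hence fixes the whole component; the
  trivialising covering of the level-`n` approximator splits it) — `isTempered_covObj_restrict`; hence
  `B^temp(R) ≌ B^temp(P)` by `S ↦ S_v` (`restrictTemperedEquiv`) and the EXPLICIT chart `restrictChart p` with
  group `P` ON THE NOSE (`restrictChart_G`);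
* transporting along the tree's cusp-omission equivalence `B^temp(cuspGraph p) ≌ B^temp(R)`
  (`nonempty_btempCat_equivalence`, `TemperedPiChart.transport`, abc-iut row W4-30): the EXPLICIT chart
  **`cuspChart p : TemperedPiChart (cuspGraph p)` with `(cuspChart p).G = P`** (`cuspChart_G`, `rfl`) — the
  first explicit tempered fundamental group in the tree of a semi-graph of anabelioids WITH AN EDGE;
* for `restrictChart p` the identity of `P` is a verticial homomorphism and, by Prop. 3.2
  (`ResIsoResIff_holds`), the verticial subgroups at the vertex are EXACTLY `{⊤}`
  (`verticialSubgroups_restrictChart_eq`).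

A witness certifies consistency / non-vacuity only; no statement of the paper is touched, strengthened or
assumed; no instance, no notation, no `Prop` fact is declared.  Nothing here bears on [IUTchIII] Cor. 3.12.
-/

noncomputable section

namespace Literature.AnabelianGeometry.SemiGraphs

namespace IwahoriWitness

open CategoryTheory Topology ProfiniteSemiGraph
open Literature.AlgebraicGeometry.Frobenioids (IsSlimGroup)
open Literature.AlgebraicGeometry.Frobenioids.QuasiTemperoid.BTempConnected
  (hom_ext_apply ρ_one_apply ρ_mul_apply)

variable (p : ℕ) [Fact p.Prime]

/-! ### Coverings of the cusp-omitted restriction are `P`-sets; every covering is tempered -/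

/-- The base vertex of the cusp-omitted restriction. [cite: MochizukiSemiAnbd2006, §1 p.13] -/
def restrictVertex : ((cuspGraph p).restrict (cuspOmission p)).graph.Vertex := ⟨PUnit.unit, Set.mem_univ _⟩

/-- The covering of the cusp-omitted restriction with vertex fibre `X` (no edge to glue).
[cite: MochizukiSemiAnbd2006, Def 3.5(i) p.37] -/
def restrictCovObj (X : BTemp (Iw p)) : CovObj ((cuspGraph p).restrict (cuspOmission p)) where
  SV := fun _ => X
  SE := fun e => False.elim e.2
  glue := fun b => False.elim b.2

/-- The functor `X ↦ (X at the vertex)` from `P`-sets to coverings of the restriction.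
[cite: MochizukiSemiAnbd2006, Def 3.5(i) p.37] -/
def restrictCovFunctor : BTemp (Iw p) ⥤ CovObj ((cuspGraph p).restrict (cuspOmission p)) where
  obj X := restrictCovObj p X
  map f := { fV := fun _ => f, fE := fun e => False.elim e.2, comm := fun b => False.elim b.2 }
  map_id _ := CovHom.ext (funext fun _ => rfl) (funext fun e => False.elim e.2)
  map_comp _ _ := CovHom.ext (funext fun _ => rfl) (funext fun e => False.elim e.2)

/-- In a `Π`-set, if a normal subgroup `N` fixes `x` then it fixes `g · x`. [folklore] -/
private theorem fixed_smul_of_normal {G : Type} [Group G] [TopologicalSpace G] (N : Subgroup G)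
    (hN : N.Normal) (X : BTemp G) (x : X.obj.V) (g : G) (hx : ∀ γ ∈ N, X.obj.ρ γ x = x) :
    ∀ γ ∈ N, X.obj.ρ γ (X.obj.ρ g x) = X.obj.ρ g x := by
  intro γ hγ
  have hc : g⁻¹ * γ * g⁻¹⁻¹ ∈ N := hN.conj_mem γ hγ g⁻¹
  rw [inv_inv] at hc
  calc X.obj.ρ γ (X.obj.ρ g x)
      = X.obj.ρ (g * (g⁻¹ * γ * g)) x := by
        rw [← ρ_mul_apply]; congr 1; group
    _ = X.obj.ρ g x := by rw [ρ_mul_apply, hx _ hc]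

/-- In a `Π`-set, a normal subgroup `N` fixes `x` iff it fixes `g · x`. [folklore] -/
private theorem fixed_iff_fixed_smul_of_normal {G : Type} [Group G] [TopologicalSpace G]
    (N : Subgroup G) (hN : N.Normal) (X : BTemp G) (x : X.obj.V) (g : G) :
    (∀ γ ∈ N, X.obj.ρ γ x = x) ↔ ∀ γ ∈ N, X.obj.ρ γ (X.obj.ρ g x) = X.obj.ρ g x := by
  refine ⟨fixed_smul_of_normal N hN X x g, fun h => ?_⟩
  have h' := fixed_smul_of_normal N hN X (X.obj.ρ g x) g⁻¹ h
  rwa [← ρ_mul_apply, inv_mul_cancel, ρ_one_apply] at h'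

/-- The level box `Ker(P ↠ P_n)` fixes the point `t` of the vertex fibre.
[cite: MochizukiSemiAnbd2006, Def 3.5(ii) p.37] -/
private def FixedByLevel (S : CovObj ((cuspGraph p).restrict (cuspOmission p))) (n : ℕ) : S.Point → Prop
  | Sum.inl ⟨v, t⟩ => ∀ γ : Iw p, γ ∈ (Iw.toMod (p := p) n).ker → (S.SV v).obj.ρ γ t = t
  | Sum.inr ⟨e, _⟩ => False.elim e.2

/-- Level-fixedness is invariant along the adjacency relation generating the components (the level box is
normal). [cite: MochizukiSemiAnbd2006, Def 3.5(ii) p.37] -/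
private theorem fixedByLevel_iff_of_adj (S : CovObj ((cuspGraph p).restrict (cuspOmission p))) (n : ℕ)
    {a b : S.Point} (h : S.Adj a b) : FixedByLevel p S n a ↔ FixedByLevel p S n b := by
  cases h with
  | vertex v g x =>
    exact fixed_iff_fixed_smul_of_normal (Iw.toMod (p := p) n).ker inferInstance (S.SV v) x g
  | edge e => exact False.elim e.2
  | glue b => exact False.elim b.2

/-- Level-fixedness is constant on connected components. [cite: MochizukiSemiAnbd2006, Def 3.5(ii) p.37] -/
private theorem fixedByLevel_iff_of_sameComponent (S : CovObj ((cuspGraph p).restrict (cuspOmission p)))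
    (n : ℕ) {a b : S.Point} (h : S.SameComponent a b) : FixedByLevel p S n a ↔ FixedByLevel p S n b := by
  induction h with
  | rel x y hxy => exact fixedByLevel_iff_of_adj p S n hxy
  | refl x => exact Iff.rfl
  | symm x y _ ih => exact ih.symm
  | trans x y z _ _ ih₁ ih₂ => exact ih₁.trans ih₂

/-- **Every covering of the cusp-omitted restriction is tempered** (Def. 3.5 (ii)): the component of a point
`t` is split by the trivialising covering of the level-`n` approximator for any level box inside the (open)
stabiliser of `t`. [cite: MochizukiSemiAnbd2006, Def 3.5(ii) p.37] -/
theorem isTempered_covObj_restrict (S : CovObj ((cuspGraph p).restrict (cuspOmission p))) : S.IsTempered := by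
  intro q
  rcases q with ⟨v, t⟩ | ⟨e, _⟩
  · have hopen : IsOpen {g : Iw p | (S.SV v).obj.ρ g t = t} := (S.SV v).property.2 t
    have h1 : (1 : Iw p) ∈ {g : Iw p | (S.SV v).obj.ρ g t = t} := ρ_one_apply _ t
    obtain ⟨n, hn⟩ := Iw.exists_level_subset_of_mem_nhds (hopen.mem_nhds h1)
    have hq : FixedByLevel p S n (Sum.inl ⟨v, t⟩) := fun γ hγ => hn γ ((MonoidHom.mem_ker).mp hγ)
    obtain ⟨A, -, hA, hcard⟩ := exists_approximator_restrict_cuspOmission p n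
    have hdvd : ∀ w, Nat.card (A.FV w) ∣ Nat.card (IwMod p n) := fun w => dvd_of_eq (hcard w)
    refine ⟨A.trivCov (M := Nat.card (IwMod p n)) Nat.card_pos hdvd, A.trivCov_isFinite _ _,
      A.trivCov_hasNonemptyFibres _ _, fun q hpq => ?_⟩
    have hq' := (fixedByLevel_iff_of_sameComponent p S n hpq).mp hq
    rcases q with ⟨w, s⟩ | ⟨e, _⟩
    · intro x g hgx
      have h' : (A.objV (Nat.card (IwMod p n)) w).obj.ρ g x = x := hgx
      rw [Approximator.objV_ρ] at h'
      exact hq' g ((MonoidHom.mem_ker).mpr ((hA w g).mp (mul_eq_right.1 (Prod.ext_iff.1 h').1)))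
    · exact False.elim e.2
  · exact False.elim e.2

/-! ### `B^temp(restriction) ≌ B^temp(P)` -/

/-- The functor `B^temp(P) ⥤ B^temp(restriction)`, `X ↦` the covering with vertex fibre `X`.
[cite: MochizukiSemiAnbd2006, Def 3.5(ii) p.37] -/
def restrictExtend : BTemp (Iw p) ⥤ BTempCat ((cuspGraph p).restrict (cuspOmission p)) :=
  ObjectProperty.lift _ (restrictCovFunctor p) fun _ => isTempered_covObj_restrict p _

/-- The functor `B^temp(restriction) ⥤ B^temp(P)`, `S ↦ S_v` (restriction to the vertex).
[cite: MochizukiSemiAnbd2006, Def 3.5(ii) p.37] -/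
def restrictToVertex : BTempCat ((cuspGraph p).restrict (cuspOmission p)) ⥤ BTemp (Iw p) :=
  ObjectProperty.ι _ ⋙ restrictV ((cuspGraph p).restrict (cuspOmission p)) (restrictVertex p)

/-- A tempered covering of the restriction is (isomorphic, by identity maps, to) the covering with its own
vertex fibre. [cite: MochizukiSemiAnbd2006, Def 3.5(ii) p.37] -/
def restrictUnitIso (S : BTempCat ((cuspGraph p).restrict (cuspOmission p))) :
    S ≅ (restrictExtend p).obj ((restrictToVertex p).obj S) :=
  ObjectProperty.isoMk _
    { hom := { fV := fun v => 𝟙 (S.obj.SV v), fE := fun e => False.elim e.2,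
               comm := fun b => False.elim b.2 }
      inv := { fV := fun v => 𝟙 (S.obj.SV v), fE := fun e => False.elim e.2,
               comm := fun b => False.elim b.2 }
      hom_inv_id := CovHom.ext (funext fun _ => Category.id_comp _) (funext fun e => False.elim e.2)
      inv_hom_id := CovHom.ext (funext fun _ => Category.id_comp _) (funext fun e => False.elim e.2) }

/-- **`B^temp((cuspGraph p)|_{cuspOmission}) ≌ B^temp(P)`** via `S ↦ S_v`: a tempered covering of the
one-vertex edgeless restriction IS a countable discrete continuous `P`-set.
[cite: MochizukiSemiAnbd2006, Prop 3.6(ii) p.38] -/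
def restrictTemperedEquiv : BTempCat ((cuspGraph p).restrict (cuspOmission p)) ≌ BTemp (Iw p) :=
  CategoryTheory.Equivalence.mk (restrictToVertex p) (restrictExtend p)
    (NatIso.ofComponents (restrictUnitIso p) fun f => ObjectProperty.hom_ext _
      (CovHom.ext (funext fun v => by
          obtain ⟨⟨⟩, _⟩ := v
          exact (Category.comp_id _).trans (Category.id_comp _).symm)
        (funext fun e => False.elim e.2)))
    (NatIso.ofComponents (fun _ => Iso.refl _) fun _ => rfl)

/-- The inverse of `restrictTemperedEquiv` is `restrictExtend` (definitionally).
[cite: MochizukiSemiAnbd2006, Prop 3.6(ii) p.38] -/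
theorem restrictTemperedEquiv_inverse : (restrictTemperedEquiv p).inverse = restrictExtend p := rfl

/-- The functor of `restrictTemperedEquiv` is the restriction to the vertex (definitionally).
[cite: MochizukiSemiAnbd2006, Prop 3.6(ii) p.38] -/
theorem restrictTemperedEquiv_functor : (restrictTemperedEquiv p).functor = restrictToVertex p := rfl

/-! ### The explicit charts -/

/-- `P = ℤ_p ⋊ (1 + pℤ_p)` is second countable (homeomorphic to `ℤ_p × ℤ_p`); [IUTchI] Rmk. 2.5.3 (i) (T6) asks
`π₁^temp` to be Galois-countable. [cite: MochizukiSemiAnbd2006, Rmk 3.1.1 p.33] -/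
theorem secondCountableTopology_iw : SecondCountableTopology (Iw p) :=
  (Iw.homeoProd (p := p)).isEmbedding.secondCountableTopology

/-- **The explicit tempered fundamental group chart of the cusp-omitted restriction**: `π₁^temp` may be taken
to be `P` itself, with `B^temp ≌ B^temp(P)` the restriction to the vertex.
[cite: MochizukiSemiAnbd2006, Prop 3.6(ii) p.38] -/
def restrictChart : TemperedPiChart ((cuspGraph p).restrict (cuspOmission p)) where
  G := Iw p
  isTempered := IsTempered.of_profinite
  secondCountableTopology := secondCountableTopology_iw p
  equiv := restrictTemperedEquiv p

/-- The group of the explicit chart of the restriction is `P` (definitionally).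
[cite: MochizukiSemiAnbd2006, Prop 3.6(ii) p.38] -/
theorem restrictChart_G : (restrictChart p).G = Iw p := rfl

/-- THE cusp-omission equivalence `B^temp(cuspGraph p) ≌ B^temp(restriction)`: the restriction functor
`btempRestrict` made an equivalence ("omission of cuspidal edges does not affect the tempered fundamental
group", [IUTchI] §2 p. 44; tree: `isEquivalence_btempRestrict`, abc-iut row W4-30) — its `functor` is
`btempRestrict` on the nose. [cite: Mochizuki2012, §2 p.44] -/
def cuspOmissionEquiv :
    BTempCat (cuspGraph p) ≌ BTempCat ((cuspGraph p).restrict (cuspOmission p)) :=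
  haveI := isEquivalence_btempRestrict (cuspOmission_isCuspOmission p)
  ((cuspGraph p).btempRestrict (cuspOmission p)).asEquivalence

/-- The functor of `cuspOmissionEquiv p` is the restriction of tempered coverings (definitionally).
[cite: Mochizuki2012, §2 p.44] -/
theorem cuspOmissionEquiv_functor :
    (cuspOmissionEquiv p).functor = (cuspGraph p).btempRestrict (cuspOmission p) := rfl

/-- **The explicit tempered fundamental group chart of `cuspGraph p`** — a semi-graph of anabelioids WITH AN
EDGE (a cusp): `π₁^temp(cuspGraph p)` may be taken to be the vertex group `P = ℤ_p ⋊ (1 + pℤ_p)` itself, the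
equivalence `B^temp(cuspGraph p) ≌ B^temp(P)` being (cusp omission) then (restriction to the vertex).
[cite: Mochizuki2012, §2 p.44] -/
def cuspChart : TemperedPiChart (cuspGraph p) := (restrictChart p).transport (cuspOmissionEquiv p)

/-- **`π₁^temp(cuspGraph p) = P` on the nose** (definitionally). [cite: Mochizuki2012, §2 p.44] -/
theorem cuspChart_G : (cuspChart p).G = Iw p := rfl

/-- The two explicit charts of the cusp-omission pair have literally the same group.
[cite: Mochizuki2012, §2 p.44] -/
theorem cuspChart_G_eq_restrictChart_G : (cuspChart p).G = (restrictChart p).G := rfl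

/-! ### The identity is a verticial homomorphism of the restriction chart; its verticial subgroups are `{⊤}` -/

/-- `X ≅ B^temp(id)(X)` by the identity map. [cite: MochizukiSemiAnbd2006, Rmk 3.1.2 pp.33-34] -/
def resIdIsoIw (X : BTemp (Iw p)) : X ≅ (BTemp.res (ContinuousMonoidHom.id (Iw p))).obj X where
  hom := ObjectProperty.homMk
    { hom := TypeCat.ofHom fun x : X.obj.V => (x : X.obj.V)
      comm := fun g => by
        apply ConcreteCategory.hom_ext
        intro x
        rfl }
  inv := ObjectProperty.homMk
    { hom := TypeCat.ofHom fun x : X.obj.V => (x : X.obj.V)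
      comm := fun g => by
        apply ConcreteCategory.hom_ext
        intro x
        rfl }
  hom_inv_id := hom_ext_apply fun _ => rfl
  inv_hom_id := hom_ext_apply fun _ => rfl

/-- For the explicit chart of the restriction, `equiv.inverse ⋙ ι ⋙ restrictV` at the vertex is (isomorphic
by identity maps to) `B^temp(id_P)`. [cite: MochizukiSemiAnbd2006, Thm 3.7(i) p.40] -/
def restrictChartRestrictIso :
    (restrictChart p).equiv.inverse ⋙ ObjectProperty.ι _ ⋙
        restrictV ((cuspGraph p).restrict (cuspOmission p)) (restrictVertex p) ≅
      BTemp.res (ContinuousMonoidHom.id (Iw p)) :=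
  NatIso.ofComponents (fun X => resIdIsoIw p X) fun _ => hom_ext_apply fun _ => rfl

/-- **The identity of `P` is a verticial homomorphism** at the vertex of the restriction, for the explicit
chart. [cite: MochizukiSemiAnbd2006, Thm 3.7(i) p.40] -/
theorem isVerticialHom_id_restrictChart :
    IsVerticialHom (restrictChart p) (restrictVertex p) (ContinuousMonoidHom.id (Iw p)) :=
  ⟨restrictChartRestrictIso p⟩

/-- **The whole group `P` is a verticial subgroup** of `π₁^temp(restriction) = P` (explicit chart).
[cite: MochizukiSemiAnbd2006, Thm 3.7(i) p.40] -/
theorem top_mem_verticialSubgroups_restrictChart :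
    (⊤ : Subgroup (Iw p)) ∈ verticialSubgroups (restrictChart p) (restrictVertex p) := by
  refine ⟨ContinuousMonoidHom.id (Iw p), ⟨restrictChartRestrictIso p⟩, ?_⟩
  ext g
  simp only [Subgroup.mem_top, true_iff]
  exact ⟨g, rfl⟩

/-- **Every verticial homomorphism of the explicit restriction chart is an inner automorphism of `P`**
(Prop. 3.2, injectivity half `ResIsoResIff_holds`, applied to `B^temp(φ) ≅ B^temp(id)`).
[cite: MochizukiSemiAnbd2006, Prop 3.2 p.35] -/
theorem exists_conj_eq_of_isVerticialHom_restrictChart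
    (φ : ((cuspGraph p).restrict (cuspOmission p)).Gv (restrictVertex p) →ₜ* (restrictChart p).G)
    (hφ : IsVerticialHom (restrictChart p) (restrictVertex p) φ) :
    ∃ g : Iw p, ∀ x : Iw p, g * x * g⁻¹ = φ x := by
  obtain ⟨e⟩ := hφ
  haveI : SecondCountableTopology (Iw p) := secondCountableTopology_iw p
  exact (ResIsoResIff_holds (Iw p) (Iw p) IsTempered.of_profinite IsTempered.of_profinite
    (ContinuousMonoidHom.id (Iw p)) φ).mp ⟨(restrictChartRestrictIso p).symm ≪≫ e⟩

/-- **The verticial subgroups of the explicit restriction chart at the vertex are exactly `{P}`**.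
[cite: MochizukiSemiAnbd2006, Thm 3.7(i) p.40] -/
theorem verticialSubgroups_restrictChart_eq :
    verticialSubgroups (restrictChart p) (restrictVertex p) = {⊤} := by
  ext H
  constructor
  · rintro ⟨φ, hφ, rfl⟩
    obtain ⟨g, hg⟩ := exists_conj_eq_of_isVerticialHom_restrictChart p φ hφ
    rw [Set.mem_singleton_iff, eq_top_iff]
    intro y _
    obtain ⟨y, rfl⟩ : ∃ y' : Iw p, y' = y := ⟨y, rfl⟩
    refine ⟨g⁻¹ * y * g, ?_⟩
    change φ (g⁻¹ * y * g) = y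
    rw [← hg]
    group
  · rintro rfl
    exact top_mem_verticialSubgroups_restrictChart p

/-! ### The identity of `P` is a verticial homomorphism of `cuspChart p`; its verticial subgroups are `{⊤}` -/

/-- For the explicit chart of `cuspGraph p`, `equiv.inverse ⋙ ι ⋙ restrictV` at the vertex is isomorphic to
`B^temp(id_P)`: through the counit of the cusp-omission equivalence (restricting the extended covering back
to the vertex gives the vertex fibre). [cite: MochizukiSemiAnbd2006, Thm 3.7(i) p.40] -/
def cuspChartRestrictIso (v : (cuspGraph p).graph.Vertex) :
    (cuspChart p).equiv.inverse ⋙ ObjectProperty.ι _ ⋙ restrictV (cuspGraph p) v ≅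
      BTemp.res (ContinuousMonoidHom.id (Iw p)) :=
  Functor.isoWhiskerLeft (restrictChart p).equiv.inverse
      (Functor.isoWhiskerRight (cuspOmissionEquiv p).counitIso
        (ObjectProperty.ι _ ⋙ restrictV ((cuspGraph p).restrict (cuspOmission p)) (restrictVertex p))) ≪≫
    restrictChartRestrictIso p

/-- **The identity of `P` is a verticial homomorphism at the vertex of `cuspGraph p`** for the explicit chart
`cuspChart p`. [cite: MochizukiSemiAnbd2006, Thm 3.7(i) p.40] -/
theorem isVerticialHom_id_cuspChart (v : (cuspGraph p).graph.Vertex) :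
    IsVerticialHom (cuspChart p) v (ContinuousMonoidHom.id (Iw p)) :=
  ⟨cuspChartRestrictIso p v⟩

/-- **`P` is a verticial subgroup of `π₁^temp(cuspGraph p) = P`** (explicit chart).
[cite: MochizukiSemiAnbd2006, Thm 3.7(i) p.40] -/
theorem top_mem_verticialSubgroups_cuspChart (v : (cuspGraph p).graph.Vertex) :
    (⊤ : Subgroup (Iw p)) ∈ verticialSubgroups (cuspChart p) v := by
  refine ⟨ContinuousMonoidHom.id (Iw p), ⟨cuspChartRestrictIso p v⟩, ?_⟩
  ext g
  simp only [Subgroup.mem_top, true_iff]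
  exact ⟨g, rfl⟩

/-- Every verticial homomorphism of `cuspChart p` is an inner automorphism of `P` (Prop. 3.2).
[cite: MochizukiSemiAnbd2006, Prop 3.2 p.35] -/
theorem exists_conj_eq_of_isVerticialHom_cuspChart (v : (cuspGraph p).graph.Vertex)
    (φ : (cuspGraph p).Gv v →ₜ* (cuspChart p).G) (hφ : IsVerticialHom (cuspChart p) v φ) :
    ∃ g : Iw p, ∀ x : Iw p, g * x * g⁻¹ = φ x := by
  obtain ⟨e⟩ := hφ
  haveI : SecondCountableTopology (Iw p) := secondCountableTopology_iw p
  exact (ResIsoResIff_holds (Iw p) (Iw p) IsTempered.of_profinite IsTempered.of_profinite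
    (ContinuousMonoidHom.id (Iw p)) φ).mp ⟨(cuspChartRestrictIso p v).symm ≪≫ e⟩

/-- **The verticial subgroups of `cuspChart p` at the vertex are exactly `{P}`** — on a semi-graph of
anabelioids WITH a (cuspidal) edge. [cite: MochizukiSemiAnbd2006, Thm 3.7(i) p.40] -/
theorem verticialSubgroups_cuspChart_eq (v : (cuspGraph p).graph.Vertex) :
    verticialSubgroups (cuspChart p) v = {⊤} := by
  ext H
  constructor
  · rintro ⟨φ, hφ, rfl⟩
    obtain ⟨g, hg⟩ := exists_conj_eq_of_isVerticialHom_cuspChart p v φ hφ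
    rw [Set.mem_singleton_iff, eq_top_iff]
    intro y _
    obtain ⟨y, rfl⟩ : ∃ y' : Iw p, y' = y := ⟨y, rfl⟩
    refine ⟨g⁻¹ * y * g, ?_⟩
    change φ (g⁻¹ * y * g) = y
    rw [← hg]
    group
  · rintro rfl
    exact top_mem_verticialSubgroups_cuspChart p v

/-- Non-vacuity record: a semi-graph of anabelioids with an OPEN edge, satisfying the hypotheses of Thm. 3.7,
with an explicit tempered fundamental group chart whose group is a given profinite group (`P`).
[cite: MochizukiSemiAnbd2006, Prop 3.6(ii) p.38] -/
theorem exists_thm37Hypotheses_with_cusp_and_chart :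
    ∃ (𝒢 : ProfiniteSemiGraph.{0}) (c : TemperedPiChart 𝒢),
      (∃ e : 𝒢.graph.Edge, 𝒢.graph.IsOpenEdge e) ∧ 𝒢.Thm37Hypotheses ∧ c.G = Iw 2 :=
  ⟨cuspGraph 2, cuspChart 2, ⟨PUnit.unit, cuspSemiGraph_isOpenEdge _⟩, cuspGraph_thm37Hypotheses 2, rfl⟩

end IwahoriWitness

end Literature.AnabelianGeometry.SemiGraphs

end
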